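import Summits.ResolutionOfSingularities.ResolutionOfSingularities.Theorems.FrobeniusClosingPatchingRelPerfectConeDepthSmoothQuadricDisc
import HarnessLib

/-!
# Crux `PatchingRelPerfect` (stmt-ResolutionOfSingularities-16161), chain W5.2 — RUNG «r-binorm-quadric-ℓ» BY NAME: the quadrics
# `N(x₀,x₁) + c·N′(x₂,x₃)` — orthogonal sum of two binary forms with unit discriminants, `c` a unit — at every depth

[OURS · L1 W5.2 · rung tool] Replaces the role of NO printed item; NOT a statement of the manuscript under review; fact-free,
any characteristic, any residue field, no completeness, no coefficient field.  AI-written (AI review is weaker than expert review).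

`S` regular local of dimension `4`, `x₀, …, x₃` a regular system of parameters, `N(u,v) = u² + b uv + a v²`,
`N′(u,v) = u² + b′ uv + a′ v²` with `b² − 4a`, `b′² − 4a′ ∈ S×`, `c ∈ S×`, `q = N(x₀,x₁) + c N′(x₂,x₃)`.  THEN
`(q) + 𝔪^{ℓ+2} ∈ 𝒞` for EVERY `ℓ` with the blow-up-form core conclusion (`binormQuadricRung_of_ringKrullDim`, core dress
`atomDimFourBlowupAt_binormQuadric`) by `smoothQuadricRung_of_ringKrullDim`: the reduced quadric is smooth, with the Bézout identities
(chart `T₀ = 1`) `4ā F₀ − (∂₁F₀)² − 2ā (T₂∂₂F₀ + T₃∂₃F₀) = 4ā − b̄²`, (chart `T₁ = 1`) the same with `T₀`, (chart `T₂ = 1`)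
`4ā′c̄ F₂ − (∂₃F₂)² − 2ā′c̄ (T₀∂₀F₂ + T₁∂₁F₂) = c̄²(4ā′ − b̄′²)`, (chart `T₃ = 1`) likewise.  COVERAGE: every NONDEGENERATE quaternary
quadratic form over the residue field is, after a linear change of parameters and up to a unit, of this shape (odd characteristic:
diagonal forms `b = b′ = 0`; characteristic `2`: orthogonal sum of two regular binary forms) — in particular the ANISOTROPIC quaternary
forms; together with «r-disc» (`x₀x₁ + N(x₂,x₃)`) and g4's split quadric this closes the RANK-4 one-form graded members at every depth.

## References
* J. Kollár, *Lectures on Resolution of Singularities* (2007), 3.61, (3.111) Step 3. [Kollar2007]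
* H. Matsumura, *Commutative Ring Theory*, CUP 1986, Thm. 30.3. [Matsumura1987]
* The Stacks Project, Tag 080A. [StacksProject]
-/

set_option linter.dupNamespace false

noncomputable section

open CategoryTheory CategoryTheory.Limits AlgebraicGeometry TopologicalSpace IsLocalRing
open Literature.AlgebraicGeometry.Resolution
open Scheme.IdealSheafData
open scoped Pointwise

namespace Summit.ResolutionOfSingularities.ResolutionOfSingularities.Theorems

universe u

namespace ConeDepth

/-! ## The form `(T₀² + bT₀T₁ + aT₁²) + c (T₂² + b′T₂T₃ + a′T₃²)` and its certificates -/

section BinormForm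

variable {S : Type u} [CommRing S] (a b a' b' c : S)

/-- The form is homogeneous of degree `2`. [folklore] -/
theorem isHomogeneous_binormForm :
    (MvPolynomial.X 0 * MvPolynomial.X 0 + MvPolynomial.C b * (MvPolynomial.X 0 * MvPolynomial.X 1) +
      MvPolynomial.C a * (MvPolynomial.X 1 * MvPolynomial.X 1) +
      MvPolynomial.C c * (MvPolynomial.X 2 * MvPolynomial.X 2 + MvPolynomial.C b' * (MvPolynomial.X 2 * MvPolynomial.X 3) +
        MvPolynomial.C a' * (MvPolynomial.X 3 * MvPolynomial.X 3)) : MvPolynomial (Fin 4) S).IsHomogeneous 2 := by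
  have hX : ∀ j : Fin 4, (MvPolynomial.X j : MvPolynomial (Fin 4) S).IsHomogeneous 1 := fun j =>
    MvPolynomial.isHomogeneous_X S j
  have hC : ∀ s : S, (MvPolynomial.C s : MvPolynomial (Fin 4) S).IsHomogeneous 0 := fun s =>
    MvPolynomial.isHomogeneous_C _ s
  have hXX : ∀ j k : Fin 4, (MvPolynomial.X j * MvPolynomial.X k : MvPolynomial (Fin 4) S).IsHomogeneous 2 := fun j k =>
    (hX j).mul (hX k)
  have hCXX : ∀ (s : S) (j k : Fin 4), (MvPolynomial.C s * (MvPolynomial.X j * MvPolynomial.X k) :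
      MvPolynomial (Fin 4) S).IsHomogeneous 2 := fun s j k => by simpa using (hC s).mul (hXX j k)
  have hN' : (MvPolynomial.X 2 * MvPolynomial.X 2 + MvPolynomial.C b' * (MvPolynomial.X 2 * MvPolynomial.X 3) +
      MvPolynomial.C a' * (MvPolynomial.X 3 * MvPolynomial.X 3) : MvPolynomial (Fin 4) S).IsHomogeneous 2 :=
    ((hXX 2 2).add (hCXX b' 2 3)).add (hCXX a' 3 3)
  have hcN' := (hC c).mul hN'
  simp only [zero_add] at hcN'
  exact (((hXX 0 0).add (hCXX b 0 1)).add (hCXX a 1 1)).add hcN'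

/-- `Q(x) = (x₀² + b x₀x₁ + a x₁²) + c (x₂² + b′ x₂x₃ + a′ x₃²)`. [folklore] -/
theorem eval_binormForm (x : Fin 4 → S) :
    MvPolynomial.eval x (MvPolynomial.X 0 * MvPolynomial.X 0 + MvPolynomial.C b * (MvPolynomial.X 0 * MvPolynomial.X 1) +
      MvPolynomial.C a * (MvPolynomial.X 1 * MvPolynomial.X 1) +
      MvPolynomial.C c * (MvPolynomial.X 2 * MvPolynomial.X 2 + MvPolynomial.C b' * (MvPolynomial.X 2 * MvPolynomial.X 3) +
        MvPolynomial.C a' * (MvPolynomial.X 3 * MvPolynomial.X 3))) =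
      (x 0 ^ 2 + b * x 0 * x 1 + a * x 1 ^ 2) + c * (x 2 ^ 2 + b' * x 2 * x 3 + a' * x 3 ^ 2) := by
  simp only [map_add, map_mul, MvPolynomial.eval_X, MvPolynomial.eval_C]
  ring

variable [IsLocalRing S]

/-- The reduced chart polynomials in terms of `killVar`. [folklore] -/
theorem chartPoly_binormForm (i : Fin 4) :
    chartPoly (MvPolynomial.X 0 * MvPolynomial.X 0 + MvPolynomial.C b * (MvPolynomial.X 0 * MvPolynomial.X 1) +
      MvPolynomial.C a * (MvPolynomial.X 1 * MvPolynomial.X 1) +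
      MvPolynomial.C c * (MvPolynomial.X 2 * MvPolynomial.X 2 + MvPolynomial.C b' * (MvPolynomial.X 2 * MvPolynomial.X 3) +
        MvPolynomial.C a' * (MvPolynomial.X 3 * MvPolynomial.X 3))) i =
      killVar i 0 * killVar i 0 + MvPolynomial.C (residue S b) * (killVar i 0 * killVar i 1) +
        MvPolynomial.C (residue S a) * (killVar i 1 * killVar i 1) +
        MvPolynomial.C (residue S c) * (killVar i 2 * killVar i 2 + MvPolynomial.C (residue S b') * (killVar i 2 * killVar i 3) +
          MvPolynomial.C (residue S a') * (killVar i 3 * killVar i 3)) := by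
  simp only [chartPoly, map_add, map_mul, MvPolynomial.map_X, MvPolynomial.map_C, MvPolynomial.aeval_X,
    MvPolynomial.algHom_C, MvPolynomial.algebraMap_eq]

/-- **The first-binary-form charts** (`T₀ = 1` or `T₁ = 1`): with `s` the other variable of the first pair and `u, v` the second
pair, if `F = 1 + b̄ s + ā s² + c̄ (u² + b̄′ uv + ā′ v²)` — resp. `F = s² + b̄ s + ā + …` — the certificate is
`4ē F − (∂_s F)² − 2ē (u ∂_u F + v ∂_v F) = unit`, `ē` the relevant extreme coefficient. We state the common algebraic core: a
polynomial identity `G = C d` with `G ∈ (F, ∂F)` and `d ≠ 0`. [cite: Matsumura1987, Thm. 30.3] -/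
theorem binorm_cert {σ : Type*} {K : Type u} [Field K] (F : MvPolynomial σ K) (s u v : σ)
    (e₀ e₁ e₂ d : K) (hd : d ≠ 0)
    (hG : MvPolynomial.C e₀ * F - MvPolynomial.C e₁ * (MvPolynomial.pderiv s F * MvPolynomial.pderiv s F) -
      MvPolynomial.C e₂ * (MvPolynomial.X u * MvPolynomial.pderiv u F + MvPolynomial.X v * MvPolynomial.pderiv v F) =
      MvPolynomial.C d) :
    Ideal.span (insert F (Set.range fun t => MvPolynomial.pderiv t F)) = ⊤ := by
  set I := Ideal.span (insert F (Set.range fun t => MvPolynomial.pderiv t F)) with hI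
  have hF : F ∈ I := Ideal.subset_span (Set.mem_insert _ _)
  have hdF : ∀ t, MvPolynomial.pderiv t F ∈ I := fun t =>
    Ideal.subset_span (Set.mem_insert_of_mem _ (Set.mem_range_self t))
  have hmem : MvPolynomial.C e₀ * F - MvPolynomial.C e₁ * (MvPolynomial.pderiv s F * MvPolynomial.pderiv s F) -
      MvPolynomial.C e₂ * (MvPolynomial.X u * MvPolynomial.pderiv u F + MvPolynomial.X v * MvPolynomial.pderiv v F) ∈ I :=
    I.sub_mem (I.sub_mem (I.mul_mem_left _ hF) (I.mul_mem_left _ (I.mul_mem_left _ (hdF s))))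
      (I.mul_mem_left _ (I.add_mem (I.mul_mem_left _ (hdF u)) (I.mul_mem_left _ (hdF v))))
  exact ideal_eq_top_of_mem_of_eq_C hmem hG hd

/-- Chart `T₀ = 1`. [cite: Matsumura1987, Thm. 30.3] -/
theorem binormForm_smooth_zero (hD : IsUnit (b ^ 2 - 4 * a)) :
    Ideal.span (insert (chartPoly (MvPolynomial.X 0 * MvPolynomial.X 0 + MvPolynomial.C b * (MvPolynomial.X 0 * MvPolynomial.X 1) +
        MvPolynomial.C a * (MvPolynomial.X 1 * MvPolynomial.X 1) +
        MvPolynomial.C c * (MvPolynomial.X 2 * MvPolynomial.X 2 + MvPolynomial.C b' * (MvPolynomial.X 2 * MvPolynomial.X 3) +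
          MvPolynomial.C a' * (MvPolynomial.X 3 * MvPolynomial.X 3))) 0)
      (Set.range fun t => MvPolynomial.pderiv t (chartPoly (MvPolynomial.X 0 * MvPolynomial.X 0 +
        MvPolynomial.C b * (MvPolynomial.X 0 * MvPolynomial.X 1) + MvPolynomial.C a * (MvPolynomial.X 1 * MvPolynomial.X 1) +
        MvPolynomial.C c * (MvPolynomial.X 2 * MvPolynomial.X 2 + MvPolynomial.C b' * (MvPolynomial.X 2 * MvPolynomial.X 3) +
          MvPolynomial.C a' * (MvPolynomial.X 3 * MvPolynomial.X 3))) 0))) = ⊤ := by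
  classical
  have hd : (4 : ResidueField S) * residue S a - residue S b ^ 2 ≠ 0 := by
    have h := (hD.map (residue S)).ne_zero
    rw [map_sub, map_pow, map_mul, map_ofNat] at h
    intro h0; apply h; linear_combination (-1 : ResidueField S) * h0
  rw [chartPoly_binormForm, killVar_self, killVar_of_ne 0 1 (by decide), killVar_of_ne 0 2 (by decide),
    killVar_of_ne 0 3 (by decide)]
  set F : MvPolynomial {j : Fin 4 // j ≠ (0 : Fin 4)} (ResidueField S) :=
    1 * 1 + MvPolynomial.C (residue S b) * (1 * MvPolynomial.X ⟨1, by decide⟩) +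
      MvPolynomial.C (residue S a) * (MvPolynomial.X ⟨1, by decide⟩ * MvPolynomial.X ⟨1, by decide⟩) +
      MvPolynomial.C (residue S c) * (MvPolynomial.X ⟨2, by decide⟩ * MvPolynomial.X ⟨2, by decide⟩ +
        MvPolynomial.C (residue S b') * (MvPolynomial.X ⟨2, by decide⟩ * MvPolynomial.X ⟨3, by decide⟩) +
        MvPolynomial.C (residue S a') * (MvPolynomial.X ⟨3, by decide⟩ * MvPolynomial.X ⟨3, by decide⟩)) with hF
  have h12 : (⟨1, by decide⟩ : {j : Fin 4 // j ≠ (0 : Fin 4)}) ≠ ⟨2, by decide⟩ := by decide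
  have h13 : (⟨1, by decide⟩ : {j : Fin 4 // j ≠ (0 : Fin 4)}) ≠ ⟨3, by decide⟩ := by decide
  have h23 : (⟨2, by decide⟩ : {j : Fin 4 // j ≠ (0 : Fin 4)}) ≠ ⟨3, by decide⟩ := by decide
  have hp1 : MvPolynomial.pderiv (⟨1, by decide⟩ : {j : Fin 4 // j ≠ (0 : Fin 4)}) F =
      MvPolynomial.C (residue S b) + 2 * (MvPolynomial.C (residue S a) * MvPolynomial.X ⟨1, by decide⟩) := by
    rw [hF]; simp [MvPolynomial.pderiv_X]; ring
  have hp2 : MvPolynomial.pderiv (⟨2, by decide⟩ : {j : Fin 4 // j ≠ (0 : Fin 4)}) F =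
      2 * (MvPolynomial.C (residue S c) * MvPolynomial.X ⟨2, by decide⟩) +
        MvPolynomial.C (residue S c) * (MvPolynomial.C (residue S b') * MvPolynomial.X ⟨3, by decide⟩) := by
    rw [hF]; simp [MvPolynomial.pderiv_X]; ring
  have hp3 : MvPolynomial.pderiv (⟨3, by decide⟩ : {j : Fin 4 // j ≠ (0 : Fin 4)}) F =
      MvPolynomial.C (residue S c) * (MvPolynomial.C (residue S b') * MvPolynomial.X ⟨2, by decide⟩) +
        2 * (MvPolynomial.C (residue S c) * (MvPolynomial.C (residue S a') * MvPolynomial.X ⟨3, by decide⟩)) := by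
    rw [hF]; simp [MvPolynomial.pderiv_X]; ring
  refine binorm_cert F ⟨1, by decide⟩ ⟨2, by decide⟩ ⟨3, by decide⟩ (4 * residue S a) 1 (2 * residue S a)
    (4 * residue S a - residue S b ^ 2) hd ?_
  rw [hp1, hp2, hp3, hF]
  simp only [map_mul, map_sub, map_pow, map_ofNat, map_one]
  ring

/-- Chart `T₁ = 1`. [cite: Matsumura1987, Thm. 30.3] -/
theorem binormForm_smooth_one (hD : IsUnit (b ^ 2 - 4 * a)) :
    Ideal.span (insert (chartPoly (MvPolynomial.X 0 * MvPolynomial.X 0 + MvPolynomial.C b * (MvPolynomial.X 0 * MvPolynomial.X 1) +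
        MvPolynomial.C a * (MvPolynomial.X 1 * MvPolynomial.X 1) +
        MvPolynomial.C c * (MvPolynomial.X 2 * MvPolynomial.X 2 + MvPolynomial.C b' * (MvPolynomial.X 2 * MvPolynomial.X 3) +
          MvPolynomial.C a' * (MvPolynomial.X 3 * MvPolynomial.X 3))) 1)
      (Set.range fun t => MvPolynomial.pderiv t (chartPoly (MvPolynomial.X 0 * MvPolynomial.X 0 +
        MvPolynomial.C b * (MvPolynomial.X 0 * MvPolynomial.X 1) + MvPolynomial.C a * (MvPolynomial.X 1 * MvPolynomial.X 1) +
        MvPolynomial.C c * (MvPolynomial.X 2 * MvPolynomial.X 2 + MvPolynomial.C b' * (MvPolynomial.X 2 * MvPolynomial.X 3) +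
          MvPolynomial.C a' * (MvPolynomial.X 3 * MvPolynomial.X 3))) 1))) = ⊤ := by
  classical
  have hd : (4 : ResidueField S) * residue S a - residue S b ^ 2 ≠ 0 := by
    have h := (hD.map (residue S)).ne_zero
    rw [map_sub, map_pow, map_mul, map_ofNat] at h
    intro h0; apply h; linear_combination (-1 : ResidueField S) * h0
  rw [chartPoly_binormForm, killVar_self, killVar_of_ne 1 0 (by decide), killVar_of_ne 1 2 (by decide),
    killVar_of_ne 1 3 (by decide)]
  set F : MvPolynomial {j : Fin 4 // j ≠ (1 : Fin 4)} (ResidueField S) :=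
    MvPolynomial.X ⟨0, by decide⟩ * MvPolynomial.X ⟨0, by decide⟩ +
      MvPolynomial.C (residue S b) * (MvPolynomial.X ⟨0, by decide⟩ * 1) + MvPolynomial.C (residue S a) * (1 * 1) +
      MvPolynomial.C (residue S c) * (MvPolynomial.X ⟨2, by decide⟩ * MvPolynomial.X ⟨2, by decide⟩ +
        MvPolynomial.C (residue S b') * (MvPolynomial.X ⟨2, by decide⟩ * MvPolynomial.X ⟨3, by decide⟩) +
        MvPolynomial.C (residue S a') * (MvPolynomial.X ⟨3, by decide⟩ * MvPolynomial.X ⟨3, by decide⟩)) with hF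
  have h02 : (⟨0, by decide⟩ : {j : Fin 4 // j ≠ (1 : Fin 4)}) ≠ ⟨2, by decide⟩ := by decide
  have h03 : (⟨0, by decide⟩ : {j : Fin 4 // j ≠ (1 : Fin 4)}) ≠ ⟨3, by decide⟩ := by decide
  have h23 : (⟨2, by decide⟩ : {j : Fin 4 // j ≠ (1 : Fin 4)}) ≠ ⟨3, by decide⟩ := by decide
  have hp0 : MvPolynomial.pderiv (⟨0, by decide⟩ : {j : Fin 4 // j ≠ (1 : Fin 4)}) F =
      2 * MvPolynomial.X ⟨0, by decide⟩ + MvPolynomial.C (residue S b) := by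
    rw [hF]; simp [MvPolynomial.pderiv_X]; ring
  have hp2 : MvPolynomial.pderiv (⟨2, by decide⟩ : {j : Fin 4 // j ≠ (1 : Fin 4)}) F =
      2 * (MvPolynomial.C (residue S c) * MvPolynomial.X ⟨2, by decide⟩) +
        MvPolynomial.C (residue S c) * (MvPolynomial.C (residue S b') * MvPolynomial.X ⟨3, by decide⟩) := by
    rw [hF]; simp [MvPolynomial.pderiv_X]; ring
  have hp3 : MvPolynomial.pderiv (⟨3, by decide⟩ : {j : Fin 4 // j ≠ (1 : Fin 4)}) F =
      MvPolynomial.C (residue S c) * (MvPolynomial.C (residue S b') * MvPolynomial.X ⟨2, by decide⟩) +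
        2 * (MvPolynomial.C (residue S c) * (MvPolynomial.C (residue S a') * MvPolynomial.X ⟨3, by decide⟩)) := by
    rw [hF]; simp [MvPolynomial.pderiv_X]; ring
  -- `4F − (∂₀F)² − 2(T₂∂₂F + T₃∂₃F) = 4ā − b̄²`
  refine binorm_cert F ⟨0, by decide⟩ ⟨2, by decide⟩ ⟨3, by decide⟩ 4 1 2 (4 * residue S a - residue S b ^ 2) hd ?_
  rw [hp0, hp2, hp3, hF]
  simp only [map_mul, map_sub, map_pow, map_ofNat, map_one]
  ring

/-- Chart `T₂ = 1`. [cite: Matsumura1987, Thm. 30.3] -/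
theorem binormForm_smooth_two (hD' : IsUnit (b' ^ 2 - 4 * a')) (hc : IsUnit c) :
    Ideal.span (insert (chartPoly (MvPolynomial.X 0 * MvPolynomial.X 0 + MvPolynomial.C b * (MvPolynomial.X 0 * MvPolynomial.X 1) +
        MvPolynomial.C a * (MvPolynomial.X 1 * MvPolynomial.X 1) +
        MvPolynomial.C c * (MvPolynomial.X 2 * MvPolynomial.X 2 + MvPolynomial.C b' * (MvPolynomial.X 2 * MvPolynomial.X 3) +
          MvPolynomial.C a' * (MvPolynomial.X 3 * MvPolynomial.X 3))) 2)
      (Set.range fun t => MvPolynomial.pderiv t (chartPoly (MvPolynomial.X 0 * MvPolynomial.X 0 +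
        MvPolynomial.C b * (MvPolynomial.X 0 * MvPolynomial.X 1) + MvPolynomial.C a * (MvPolynomial.X 1 * MvPolynomial.X 1) +
        MvPolynomial.C c * (MvPolynomial.X 2 * MvPolynomial.X 2 + MvPolynomial.C b' * (MvPolynomial.X 2 * MvPolynomial.X 3) +
          MvPolynomial.C a' * (MvPolynomial.X 3 * MvPolynomial.X 3))) 2))) = ⊤ := by
  classical
  have hd : (residue S c) ^ 2 * ((4 : ResidueField S) * residue S a' - residue S b' ^ 2) ≠ 0 := by
    have h := (hD'.map (residue S)).ne_zero
    rw [map_sub, map_pow, map_mul, map_ofNat] at h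
    refine mul_ne_zero (pow_ne_zero 2 (hc.map (residue S)).ne_zero) ?_
    intro h0; apply h; linear_combination (-1 : ResidueField S) * h0
  rw [chartPoly_binormForm, killVar_self, killVar_of_ne 2 0 (by decide), killVar_of_ne 2 1 (by decide),
    killVar_of_ne 2 3 (by decide)]
  set F : MvPolynomial {j : Fin 4 // j ≠ (2 : Fin 4)} (ResidueField S) :=
    MvPolynomial.X ⟨0, by decide⟩ * MvPolynomial.X ⟨0, by decide⟩ +
      MvPolynomial.C (residue S b) * (MvPolynomial.X ⟨0, by decide⟩ * MvPolynomial.X ⟨1, by decide⟩) +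
      MvPolynomial.C (residue S a) * (MvPolynomial.X ⟨1, by decide⟩ * MvPolynomial.X ⟨1, by decide⟩) +
      MvPolynomial.C (residue S c) * (1 * 1 + MvPolynomial.C (residue S b') * (1 * MvPolynomial.X ⟨3, by decide⟩) +
        MvPolynomial.C (residue S a') * (MvPolynomial.X ⟨3, by decide⟩ * MvPolynomial.X ⟨3, by decide⟩)) with hF
  have h01 : (⟨0, by decide⟩ : {j : Fin 4 // j ≠ (2 : Fin 4)}) ≠ ⟨1, by decide⟩ := by decide
  have h03 : (⟨0, by decide⟩ : {j : Fin 4 // j ≠ (2 : Fin 4)}) ≠ ⟨3, by decide⟩ := by decide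
  have h13 : (⟨1, by decide⟩ : {j : Fin 4 // j ≠ (2 : Fin 4)}) ≠ ⟨3, by decide⟩ := by decide
  have hp3 : MvPolynomial.pderiv (⟨3, by decide⟩ : {j : Fin 4 // j ≠ (2 : Fin 4)}) F =
      MvPolynomial.C (residue S c) * MvPolynomial.C (residue S b') +
        2 * (MvPolynomial.C (residue S c) * (MvPolynomial.C (residue S a') * MvPolynomial.X ⟨3, by decide⟩)) := by
    rw [hF]; simp [MvPolynomial.pderiv_X]; ring
  have hp0 : MvPolynomial.pderiv (⟨0, by decide⟩ : {j : Fin 4 // j ≠ (2 : Fin 4)}) F =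
      2 * MvPolynomial.X ⟨0, by decide⟩ + MvPolynomial.C (residue S b) * MvPolynomial.X ⟨1, by decide⟩ := by
    rw [hF]; simp [MvPolynomial.pderiv_X]; ring
  have hp1 : MvPolynomial.pderiv (⟨1, by decide⟩ : {j : Fin 4 // j ≠ (2 : Fin 4)}) F =
      MvPolynomial.C (residue S b) * MvPolynomial.X ⟨0, by decide⟩ +
        2 * (MvPolynomial.C (residue S a) * MvPolynomial.X ⟨1, by decide⟩) := by
    rw [hF]; simp [MvPolynomial.pderiv_X]; ring
  -- `4ā′c̄ F − (∂₃F)² − 2ā′c̄ (T₀∂₀F + T₁∂₁F) = c̄²(4ā′ − b̄′²)`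
  refine binorm_cert F ⟨3, by decide⟩ ⟨0, by decide⟩ ⟨1, by decide⟩ (4 * residue S a' * residue S c) 1
    (2 * residue S a' * residue S c) ((residue S c) ^ 2 * (4 * residue S a' - residue S b' ^ 2)) hd ?_
  rw [hp3, hp0, hp1, hF]
  simp only [map_mul, map_sub, map_pow, map_ofNat, map_one]
  ring

/-- Chart `T₃ = 1`. [cite: Matsumura1987, Thm. 30.3] -/
theorem binormForm_smooth_three (hD' : IsUnit (b' ^ 2 - 4 * a')) (hc : IsUnit c) :
    Ideal.span (insert (chartPoly (MvPolynomial.X 0 * MvPolynomial.X 0 + MvPolynomial.C b * (MvPolynomial.X 0 * MvPolynomial.X 1) +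
        MvPolynomial.C a * (MvPolynomial.X 1 * MvPolynomial.X 1) +
        MvPolynomial.C c * (MvPolynomial.X 2 * MvPolynomial.X 2 + MvPolynomial.C b' * (MvPolynomial.X 2 * MvPolynomial.X 3) +
          MvPolynomial.C a' * (MvPolynomial.X 3 * MvPolynomial.X 3))) 3)
      (Set.range fun t => MvPolynomial.pderiv t (chartPoly (MvPolynomial.X 0 * MvPolynomial.X 0 +
        MvPolynomial.C b * (MvPolynomial.X 0 * MvPolynomial.X 1) + MvPolynomial.C a * (MvPolynomial.X 1 * MvPolynomial.X 1) +
        MvPolynomial.C c * (MvPolynomial.X 2 * MvPolynomial.X 2 + MvPolynomial.C b' * (MvPolynomial.X 2 * MvPolynomial.X 3) +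
          MvPolynomial.C a' * (MvPolynomial.X 3 * MvPolynomial.X 3))) 3))) = ⊤ := by
  classical
  have hd : (residue S c) ^ 2 * ((4 : ResidueField S) * residue S a' - residue S b' ^ 2) ≠ 0 := by
    have h := (hD'.map (residue S)).ne_zero
    rw [map_sub, map_pow, map_mul, map_ofNat] at h
    refine mul_ne_zero (pow_ne_zero 2 (hc.map (residue S)).ne_zero) ?_
    intro h0; apply h; linear_combination (-1 : ResidueField S) * h0
  rw [chartPoly_binormForm, killVar_self, killVar_of_ne 3 0 (by decide), killVar_of_ne 3 1 (by decide),
    killVar_of_ne 3 2 (by decide)]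
  set F : MvPolynomial {j : Fin 4 // j ≠ (3 : Fin 4)} (ResidueField S) :=
    MvPolynomial.X ⟨0, by decide⟩ * MvPolynomial.X ⟨0, by decide⟩ +
      MvPolynomial.C (residue S b) * (MvPolynomial.X ⟨0, by decide⟩ * MvPolynomial.X ⟨1, by decide⟩) +
      MvPolynomial.C (residue S a) * (MvPolynomial.X ⟨1, by decide⟩ * MvPolynomial.X ⟨1, by decide⟩) +
      MvPolynomial.C (residue S c) * (MvPolynomial.X ⟨2, by decide⟩ * MvPolynomial.X ⟨2, by decide⟩ +
        MvPolynomial.C (residue S b') * (MvPolynomial.X ⟨2, by decide⟩ * 1) + MvPolynomial.C (residue S a') * (1 * 1)) with hF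
  have h01 : (⟨0, by decide⟩ : {j : Fin 4 // j ≠ (3 : Fin 4)}) ≠ ⟨1, by decide⟩ := by decide
  have h02 : (⟨0, by decide⟩ : {j : Fin 4 // j ≠ (3 : Fin 4)}) ≠ ⟨2, by decide⟩ := by decide
  have h12 : (⟨1, by decide⟩ : {j : Fin 4 // j ≠ (3 : Fin 4)}) ≠ ⟨2, by decide⟩ := by decide
  have hp2 : MvPolynomial.pderiv (⟨2, by decide⟩ : {j : Fin 4 // j ≠ (3 : Fin 4)}) F =
      2 * (MvPolynomial.C (residue S c) * MvPolynomial.X ⟨2, by decide⟩) + MvPolynomial.C (residue S c) * MvPolynomial.C (residue S b') := by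
    rw [hF]; simp [MvPolynomial.pderiv_X]; ring
  have hp0 : MvPolynomial.pderiv (⟨0, by decide⟩ : {j : Fin 4 // j ≠ (3 : Fin 4)}) F =
      2 * MvPolynomial.X ⟨0, by decide⟩ + MvPolynomial.C (residue S b) * MvPolynomial.X ⟨1, by decide⟩ := by
    rw [hF]; simp [MvPolynomial.pderiv_X]; ring
  have hp1 : MvPolynomial.pderiv (⟨1, by decide⟩ : {j : Fin 4 // j ≠ (3 : Fin 4)}) F =
      MvPolynomial.C (residue S b) * MvPolynomial.X ⟨0, by decide⟩ +
        2 * (MvPolynomial.C (residue S a) * MvPolynomial.X ⟨1, by decide⟩) := by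
    rw [hF]; simp [MvPolynomial.pderiv_X]; ring
  -- `4c̄ F − (∂₂F)² − 2c̄ (T₀∂₀F + T₁∂₁F) = c̄²(4ā′ − b̄′²)`
  refine binorm_cert F ⟨2, by decide⟩ ⟨0, by decide⟩ ⟨1, by decide⟩ (4 * residue S c) 1 (2 * residue S c)
    ((residue S c) ^ 2 * (4 * residue S a' - residue S b' ^ 2)) hd ?_
  rw [hp2, hp0, hp1, hF]
  simp only [map_mul, map_sub, map_pow, map_ofNat, map_one]
  ring

/-- **The reduced quadric of the binorm form is smooth on every chart.** [cite: Matsumura1987, Thm. 30.3] -/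
theorem binormForm_smooth (hD : IsUnit (b ^ 2 - 4 * a)) (hD' : IsUnit (b' ^ 2 - 4 * a')) (hc : IsUnit c) (i : Fin 4) :
    Ideal.span (insert (chartPoly (MvPolynomial.X 0 * MvPolynomial.X 0 + MvPolynomial.C b * (MvPolynomial.X 0 * MvPolynomial.X 1) +
        MvPolynomial.C a * (MvPolynomial.X 1 * MvPolynomial.X 1) +
        MvPolynomial.C c * (MvPolynomial.X 2 * MvPolynomial.X 2 + MvPolynomial.C b' * (MvPolynomial.X 2 * MvPolynomial.X 3) +
          MvPolynomial.C a' * (MvPolynomial.X 3 * MvPolynomial.X 3))) i)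
      (Set.range fun t => MvPolynomial.pderiv t (chartPoly (MvPolynomial.X 0 * MvPolynomial.X 0 +
        MvPolynomial.C b * (MvPolynomial.X 0 * MvPolynomial.X 1) + MvPolynomial.C a * (MvPolynomial.X 1 * MvPolynomial.X 1) +
        MvPolynomial.C c * (MvPolynomial.X 2 * MvPolynomial.X 2 + MvPolynomial.C b' * (MvPolynomial.X 2 * MvPolynomial.X 3) +
          MvPolynomial.C a' * (MvPolynomial.X 3 * MvPolynomial.X 3))) i))) = ⊤ := by
  fin_cases i
  · exact binormForm_smooth_zero a b a' b' c hD
  · exact binormForm_smooth_one a b a' b' c hD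
  · exact binormForm_smooth_two a b a' b' c hD' hc
  · exact binormForm_smooth_three a b a' b' c hD' hc

end BinormForm

/-! ## The rung «r-binorm-quadric-ℓ» -/

section BinormRung

variable {S : Type u} [CommRing S] [IsRegularLocalRing S]
  (x : Fin 4 → S) (hx : Ideal.span (Set.range x) = maximalIdeal S) (hdim : ringKrullDim S = (4 : ℕ))
  (a b a' b' c : S) (hD : IsUnit (b ^ 2 - 4 * a)) (hD' : IsUnit (b' ^ 2 - 4 * a')) (hc : IsUnit c) (ℓ : ℕ)

include hx hdim hD hD' hc in
/-- **RUNG «r-binorm-quadric-ℓ», UNCONDITIONAL PACKAGE**: for `S` regular local of dimension `4`, `x` spanning `𝔪`, units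
`b² − 4a`, `b′² − 4a′`, `c`, `q = (x₀² + b x₀x₁ + a x₁²) + c (x₂² + b′ x₂x₃ + a′ x₃²)` and EVERY `ℓ`: (1) `(q) + 𝔪^{ℓ+2} ∈ 𝒞`;
(2) the blow-up-form core conclusion for every `T = Bl_I Spec S`.  Every nondegenerate quaternary form type, in every characteristic.
[cite: Kollar2007, 3.61 and (3.111) Step 3] [cite: StacksProject, Tag 080A] -/
theorem binormQuadricRung_of_ringKrullDim :
    (∃ (P : Ideal S) (m : ℕ), IsLocalRing.maximalIdeal S ^ m ≤ P ∧
      ∃ (B' : Scheme.{u}) (β : B' ⟶ Spec (.of S)),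
        IsBlowup β (affineBlowup.idealSheaf
          ((Ideal.span {(x 0 ^ 2 + b * x 0 * x 1 + a * x 1 ^ 2) + c * (x 2 ^ 2 + b' * x 2 * x 3 + a' * x 3 ^ 2)} ⊔
            maximalIdeal S ^ (ℓ + 2)) * P)) ∧
        Scheme.IsRegular B') ∧
    (∀ (T : Scheme.{u}) (f : T ⟶ Spec (.of S)),
      IsBlowup f (affineBlowup.idealSheaf
        (Ideal.span {(x 0 ^ 2 + b * x 0 * x 1 + a * x 1 ^ 2) + c * (x 2 ^ 2 + b' * x 2 * x 3 + a' * x 3 ^ 2)} ⊔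
          maximalIdeal S ^ (ℓ + 2))) →
      ∃ (J : T.IdealSheafData) (T' : Scheme.{u}) (π : T' ⟶ T), J ≠ ⊥ ∧
        (∀ t : T, t ∈ J.support → f.base t = IsLocalRing.closedPoint S) ∧
        IsBlowup π J ∧ Scheme.IsRegular T') := by
  rw [← eval_binormForm a b a' b' c x]
  exact smoothQuadricRung_of_ringKrullDim x hx hdim _ (isHomogeneous_binormForm a b a' b' c)
    (binormForm_smooth a b a' b' c hD hD' hc) ℓ

end BinormRung

/-- **The registered core's binder shape on the member `(N(x₀,x₁) + c N′(x₂,x₃)) + 𝔪^{ℓ+2}`** (hypotheses of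
`stub_atomDimFourBlowup`; characteristic, completeness, perfectness and the off-fibre hypothesis unused). [cite: Kollar2007, 3.61] -/
theorem atomDimFourBlowupAt_binormQuadric (p : ℕ) (_hp : p.Prime) (S : Type) [CommRing S]
    [IsRegularLocalRing S] [CharP S p] [IsAdicComplete (IsLocalRing.maximalIdeal S) S]
    [PerfectField (IsLocalRing.ResidueField S)] (hS : ringKrullDim S = (4 : ℕ))
    (x : Fin 4 → S) (hx : Ideal.span (Set.range x) = IsLocalRing.maximalIdeal S)
    (a b a' b' c : S) (hD : IsUnit (b ^ 2 - 4 * a)) (hD' : IsUnit (b' ^ 2 - 4 * a')) (hc : IsUnit c) (ℓ : ℕ)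
    (T : Scheme.{0}) (f : T ⟶ Spec (.of S))
    (hf : IsBlowup f (affineBlowup.idealSheaf
      (Ideal.span {(x 0 ^ 2 + b * x 0 * x 1 + a * x 1 ^ 2) + c * (x 2 ^ 2 + b' * x 2 * x 3 + a' * x 3 ^ 2)} ⊔
        IsLocalRing.maximalIdeal S ^ (ℓ + 2))))
    (_hoff : ∀ t : T, f.base t ≠ IsLocalRing.closedPoint S → IsRegularLocalRing (T.presheaf.stalk t)) :
    ∃ (J : T.IdealSheafData) (T' : Scheme.{0}) (π : T' ⟶ T), J ≠ ⊥ ∧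
      (∀ t : T, t ∈ J.support → f.base t = IsLocalRing.closedPoint S) ∧
      IsBlowup π J ∧ Scheme.IsRegular T' :=
  (binormQuadricRung_of_ringKrullDim x hx hS a b a' b' c hD hD' hc ℓ).2 T f hf

end ConeDepth

end Summit.ResolutionOfSingularities.ResolutionOfSingularities.Theorems

end
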